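import Summits.BirchSwinnertonDyer.BirchSwinnertonDyer.Theorems.ResidualThetaTransportAtTwoThetaLayerLambdaCongruenceAtTwoEllipticExclusion
import HarnessLib

/-!
# Crux `ThetaLayerLambdaCongruenceAtTwo` (stmt-BirchSwinnertonDyer-20688, route ResidualThetaTransportAtTwo), line
# `birth`, stub (C3k) — ITEM B1 scaffolding: MANIN SYMBOLS of a Γ₀(N)-symbol function, their relations, and the
# vanishing of eigen-symbols on σ-fixed cosets (lead prover bsd-wall-rtt-p3 g3;
# `--supports stmt-BirchSwinnertonDyer-20688 --as helper`; closes nothing)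

HONEST FRAMING. Elementary THEOREMS about functions `Φ : ℚ → R` only; nothing about any curve or form is asserted;
BSD is not proved by any of this. Piece B1 (Manin-symbol dictionary, easy direction) of
`Cruxes/ThetaLayerLambdaCongruenceAtTwo/Lines/birth-C3k-plan.md`.

WHAT. For a Γ₀(N)-symbol function `Φ` (Manin's relation, inline as in (C3)/(C3k)) write `Φ̂(g) := Φ(g·∞)` for
`g ∈ SL₂(ℤ)` (`= Φ(a/c)`, read as `0` when `c = 0`, i.e. `Φ̂(∞) = 0`) and define its MANIN SYMBOL at `g` as
`[g]_Φ := Φ̂(g) − Φ̂(gS)` (`S = (0,−1;1,0)`, `gS·∞ = g·0`; Manin 1972, Cremona §2.2: `[g] = {g·0, g·∞}`). Then: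
* §1 COCYCLE on all of `P¹(ℚ) = SL₂(ℤ)·∞`: `Φ̂(γg) = Φ(γ·∞) + Φ̂(g)` for `γ ∈ Γ₀(N)`, `g ∈ SL₂(ℤ)`
  (`maninCusp_gamma0_mul_sl`; extends `maninCusp_mul` of `…PeriodHom` to arbitrary right factors).
* §2 MANIN SYMBOLS: `[γg]_Φ = [g]_Φ` (a function on `Γ₀(N)\SL₂(ℤ) ≅ P¹(ℤ/N)`), the TWO-TERM relation
  `[g] + [gS] = 0` and the THREE-TERM relation `[g] + [gτ] + [gτ²] = 0`, `τ = (0,−1;1,−1)` (both telescoping); the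
  involution `g ↦ εgε` (`ε = diag(−1,1)`) fixes the Manin symbols of an EVEN `Φ` (Cremona's `*`-involution).
* §3 σ-FIXED COSETS = ORDER-4 ELLIPTIC ELEMENTS: if `gSg⁻¹ ∈ Γ₀(N)` then `[g]_Φ = −Φ((gSg⁻¹)·∞)` is minus an elliptic
  period; hence, by `…EllipticExclusion` (T₂ is the identity on periods at trace-zero elements, `N` odd), for `Φ` with
  `T₂Φ = 0` (resp. `‖T₂Φ − aΦ‖ < 1`, `‖a‖ < 1`, `‖Φ‖ ≤ 1`) the Manin symbol at every σ-fixed coset VANISHES (resp. has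
  norm `< 1`): `maninSymbol_eq_zero_of_sigmaFixed_of_heckeTwo`, `norm_maninSymbol_lt_one_of_sigmaFixed`. These σ-fixed
  cosets carry exactly the `2`-torsion of the integral Manin-symbol module `ℤ[Γ₀(N)\SL₂(ℤ)]/(2-term, 3-term)`
  (Wiese, Computational arithmetic of modular forms, Prop. 5.1 / Thm. 5.7, exact over any ring; Thm. 5.9 needs the
  stabiliser orders invertible — false for `𝔽₂`), which is why the `𝔪`-eigen symbol functions of (C3k) descend to
  the torsion-free quotient `H₁(X₀(N'), cusps; ℤ) ⊗ k` although `char k = 2`.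
NOT here: the converse direction (every system of Manin symbols with the relations comes from a `Φ` — Manin's
continued-fraction theorem / Wiese Prop. 5.1 exactness in the middle), Hecke operators on Manin symbols (Merel's
Heilbronn matrices), the comparison with `periodHomology`.

References: [Manin1972] §1.5–1.7, Thm. 1.9; [CremonaAlgorithms1997] §2.2 (M-symbols, relations (2.2.5)–(2.2.7), the
`*` involution §2.1.3); [Merel1994] §1.2; Wiese, *Computational arithmetic of modular forms* (in [InamBuyukasik2019])
Prop. 5.1, Thm. 5.7, Thm. 5.9.
-/

noncomputable section

-- justification: the `Summit.BirchSwinnertonDyer.BirchSwinnertonDyer.…` path repeats a component (route-file convention)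
set_option linter.dupNamespace false

open scoped Classical MatrixGroups

open CongruenceSubgroup

namespace Summit.BirchSwinnertonDyer.BirchSwinnertonDyer.Theorems.ThetaLayerLambdaCongruenceAtTwo

variable {R : Type*} [AddCommGroup R] {N : ℕ} {Φ : ℚ → R}

/-! ## §1. The cocycle identity on `P¹(ℚ) = SL₂(ℤ)·∞` -/

section Cocycle

/-- **Cocycle identity** `Φ̂(γg) = Φ(γ·∞) + Φ̂(g)` for `γ ∈ Γ₀(N)` and ANY `g ∈ SL₂(ℤ)` (`Φ̂(h) = Φ(h·∞)`, read as `0`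
at `h·∞ = ∞`): the Γ₀(N)-symbol function extended by `Φ(∞) = 0` transforms under `Γ₀(N)` through the period
homomorphism on all of `P¹(ℚ)`. Same case analysis as `maninCusp_mul` (`g·∞ = ∞`; `γ·(g∞) ≠ ∞`; `γ·(g∞) = ∞` via
`maninCusp_neg_div`). [cite: Manin1972, §1.5 and Thm. 1.9] -/
theorem maninCusp_gamma0_mul_sl
    (hM : ∀ (γ : Gamma0 N) (r : ℚ), ((γ : SL(2, ℤ)) 1 0 : ℚ) * r + ((γ : SL(2, ℤ)) 1 1 : ℚ) ≠ 0 →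
      Φ ((((γ : SL(2, ℤ)) 0 0 : ℚ) * r + ((γ : SL(2, ℤ)) 0 1 : ℚ)) /
        (((γ : SL(2, ℤ)) 1 0 : ℚ) * r + ((γ : SL(2, ℤ)) 1 1 : ℚ))) =
        (if ((γ : SL(2, ℤ)) 1 0) = 0 then 0 else Φ ((((γ : SL(2, ℤ)) 0 0 : ℚ)) / (((γ : SL(2, ℤ)) 1 0 : ℚ)))) + Φ r)
    (γ : Gamma0 N) (g : SL(2, ℤ)) :
    (if (((γ : SL(2, ℤ)) * g) 1 0) = 0 then 0
      else Φ (((((γ : SL(2, ℤ)) * g) 0 0 : ℚ)) / ((((γ : SL(2, ℤ)) * g) 1 0 : ℚ)))) =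
      (if ((γ : SL(2, ℤ)) 1 0) = 0 then 0 else Φ ((((γ : SL(2, ℤ)) 0 0 : ℚ)) / (((γ : SL(2, ℤ)) 1 0 : ℚ)))) +
        (if (g 1 0) = 0 then 0 else Φ (((g 0 0 : ℚ)) / ((g 1 0 : ℚ)))) := by
  have hneg := fun hc ↦ maninCusp_neg_div hM γ hc
  have hMγ := hM γ
  set a : ℤ := (γ : SL(2, ℤ)) 0 0 with ha
  set b : ℤ := (γ : SL(2, ℤ)) 0 1 with hb
  set c : ℤ := (γ : SL(2, ℤ)) 1 0 with hc'
  set d : ℤ := (γ : SL(2, ℤ)) 1 1 with hd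
  set a' : ℤ := g 0 0 with ha'
  set b' : ℤ := g 0 1 with hb'
  set c' : ℤ := g 1 0 with hc''
  set d' : ℤ := g 1 1 with hd'
  have hdet : a * d - b * c = 1 := by
    have := Matrix.det_fin_two (γ : SL(2, ℤ)).1
    rw [(γ : SL(2, ℤ)).2] at this
    linear_combination -this
  have hdet' : a' * d' - b' * c' = 1 := by
    have := Matrix.det_fin_two g.1
    rw [g.2] at this
    linear_combination -this
  have e00 : (((γ : SL(2, ℤ)) * g) 0 0) = a * a' + b * c' :=
    (Matrix.two_mul_expl ((γ : SL(2, ℤ)) : Matrix (Fin 2) (Fin 2) ℤ) (g : Matrix (Fin 2) (Fin 2) ℤ)).1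
  have e10 : (((γ : SL(2, ℤ)) * g) 1 0) = c * a' + d * c' :=
    (Matrix.two_mul_expl ((γ : SL(2, ℤ)) : Matrix (Fin 2) (Fin 2) ℤ) (g : Matrix (Fin 2) (Fin 2) ℤ)).2.2.1
  rw [e00, e10]
  by_cases h0 : c' = 0
  · have had : a' * d' = 1 := by rw [h0, mul_zero, sub_zero] at hdet'; exact hdet'
    have ha'0 : a' ≠ 0 := left_ne_zero_of_mul_eq_one had
    rw [if_pos h0, add_zero, h0, mul_zero, add_zero, mul_zero, add_zero]
    by_cases hc : c = 0
    · rw [if_pos (by rw [hc, zero_mul]), if_pos hc]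
    · rw [if_neg (mul_ne_zero hc ha'0), if_neg hc]
      congr 1
      have : (a' : ℚ) ≠ 0 := by exact_mod_cast ha'0
      push_cast
      rw [mul_div_mul_right _ _ this]
  · have hc'Q : (c' : ℚ) ≠ 0 := by exact_mod_cast h0
    rw [if_neg h0]
    by_cases hx : (c : ℚ) * ((a' : ℚ) / c') + d = 0
    · have hc : c ≠ 0 := by
        rintro h
        rw [h, Int.cast_zero, zero_mul, zero_add] at hx
        have hd0 : d = 0 := by exact_mod_cast hx
        rw [h, hd0, mul_zero, mul_zero, sub_zero] at hdet
        exact zero_ne_one hdet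
      have hcQ : (c : ℚ) ≠ 0 := by exact_mod_cast hc
      have h10 : c * a' + d * c' = 0 := by
        have h : ((c : ℚ) * ((a' : ℚ) / c') + d) * c' = 0 := by rw [hx, zero_mul]
        have h' : (c : ℚ) * a' + d * c' = 0 := by
          rw [← h]; field_simp
        exact_mod_cast h'
      rw [if_pos h10, if_neg hc]
      have ex : ((a' : ℚ) / c') = -(d : ℚ) / c := by
        field_simp
        have h' : (c : ℚ) * a' + d * c' = 0 := by exact_mod_cast h10
        linear_combination h'
      rw [ex, hneg hc, add_neg_cancel]
    · have h := hMγ ((a' : ℚ) / c') hx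
      have h10Q : ((c * a' + d * c' : ℤ) : ℚ) ≠ 0 := by
        push_cast
        intro h'
        apply hx
        have : ((c : ℚ) * ((a' : ℚ) / c') + d) * c' = 0 := by rw [← h']; field_simp
        simpa [hc'Q] using this
      have h10 : c * a' + d * c' ≠ 0 := by exact_mod_cast h10Q
      rw [if_neg h10, ← h]
      congr 1
      push_cast
      field_simp

end Cocycle

/-! ## §2. Manin symbols `[g]_Φ = Φ̂(g) − Φ̂(gS)`: invariance, two- and three-term relations, the `*`-involution -/

section ManinSymbols

/-- The matrix `S = (0,−1;1,0) ∈ SL₂(ℤ)` has `(gS)·∞ = g·0`: first column of `gS` is the second column of `g`.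
[folklore] -/
theorem sl_mul_S_apply (g : SL(2, ℤ)) :
    (g * ModularGroup.S) 0 0 = g 0 1 ∧ (g * ModularGroup.S) 1 0 = g 1 1 := by
  have e := Matrix.two_mul_expl (g : Matrix (Fin 2) (Fin 2) ℤ)
    ((ModularGroup.S : SL(2, ℤ)) : Matrix (Fin 2) (Fin 2) ℤ)
  refine ⟨e.1.trans ?_, e.2.2.1.trans ?_⟩ <;> simp [ModularGroup.coe_S]

/-- **Left invariance**: `[γg]_Φ = [g]_Φ` for `γ ∈ Γ₀(N)` — the Manin symbols of `Φ` are a function on the finite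
coset space `Γ₀(N)\SL₂(ℤ) ≅ P¹(ℤ/N)` (two applications of the cocycle identity). [cite: Manin1972, §1.5–1.7] -/
theorem maninSymbol_gamma0_mul
    (hM : ∀ (γ : Gamma0 N) (r : ℚ), ((γ : SL(2, ℤ)) 1 0 : ℚ) * r + ((γ : SL(2, ℤ)) 1 1 : ℚ) ≠ 0 →
      Φ ((((γ : SL(2, ℤ)) 0 0 : ℚ) * r + ((γ : SL(2, ℤ)) 0 1 : ℚ)) /
        (((γ : SL(2, ℤ)) 1 0 : ℚ) * r + ((γ : SL(2, ℤ)) 1 1 : ℚ))) =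
        (if ((γ : SL(2, ℤ)) 1 0) = 0 then 0 else Φ ((((γ : SL(2, ℤ)) 0 0 : ℚ)) / (((γ : SL(2, ℤ)) 1 0 : ℚ)))) + Φ r)
    (γ : Gamma0 N) (g : SL(2, ℤ)) :
    ((if (((γ : SL(2, ℤ)) * g) 1 0) = 0 then 0
        else Φ (((((γ : SL(2, ℤ)) * g) 0 0 : ℚ)) / ((((γ : SL(2, ℤ)) * g) 1 0 : ℚ)))) -
      (if (((γ : SL(2, ℤ)) * g * ModularGroup.S) 1 0) = 0 then 0
        else Φ (((((γ : SL(2, ℤ)) * g * ModularGroup.S) 0 0 : ℚ)) /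
          ((((γ : SL(2, ℤ)) * g * ModularGroup.S) 1 0 : ℚ))))) =
      (if (g 1 0) = 0 then 0 else Φ (((g 0 0 : ℚ)) / ((g 1 0 : ℚ)))) -
      (if ((g * ModularGroup.S) 1 0) = 0 then 0
        else Φ ((((g * ModularGroup.S) 0 0 : ℚ)) / (((g * ModularGroup.S) 1 0 : ℚ)))) := by
  rw [mul_assoc, maninCusp_gamma0_mul_sl hM γ g, maninCusp_gamma0_mul_sl hM γ (g * ModularGroup.S)]
  abel

/-- **Two-term relation** `[g]_Φ + [gS]_Φ = 0` (telescoping: `gS² = −g` has the same cusp as `g`).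
[cite: Manin1972, Thm. 1.9] -/
theorem maninSymbol_two_term (Φ : ℚ → R) (g : SL(2, ℤ)) :
    ((if (g 1 0) = 0 then 0 else Φ (((g 0 0 : ℚ)) / ((g 1 0 : ℚ)))) -
      (if ((g * ModularGroup.S) 1 0) = 0 then 0
        else Φ ((((g * ModularGroup.S) 0 0 : ℚ)) / (((g * ModularGroup.S) 1 0 : ℚ))))) +
    ((if ((g * ModularGroup.S) 1 0) = 0 then 0
        else Φ ((((g * ModularGroup.S) 0 0 : ℚ)) / (((g * ModularGroup.S) 1 0 : ℚ)))) -
      (if ((g * ModularGroup.S * ModularGroup.S) 1 0) = 0 then 0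
        else Φ ((((g * ModularGroup.S * ModularGroup.S) 0 0 : ℚ)) /
          (((g * ModularGroup.S * ModularGroup.S) 1 0 : ℚ))))) = 0 := by
  have h1 := sl_mul_S_apply g
  have h2 := sl_mul_S_apply (g * ModularGroup.S)
  have e := Matrix.two_mul_expl (g : Matrix (Fin 2) (Fin 2) ℤ)
    ((ModularGroup.S : SL(2, ℤ)) : Matrix (Fin 2) (Fin 2) ℤ)
  have h01 : (g * ModularGroup.S) 0 1 = -g 0 0 := by
    refine e.2.1.trans ?_; simp [ModularGroup.coe_S]
  have h11 : (g * ModularGroup.S) 1 1 = -g 1 0 := by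
    refine e.2.2.2.trans ?_; simp [ModularGroup.coe_S]
  rw [h2.1, h2.2, h01, h11]
  by_cases hc : g 1 0 = 0
  · rw [if_pos hc, if_pos (neg_eq_zero.mpr hc)]; abel
  · rw [if_neg hc, if_neg (neg_ne_zero.mpr hc), Int.cast_neg, Int.cast_neg, neg_div_neg_eq]; abel

/-- **Three-term relation** `[g]_Φ + [gτ]_Φ + [gτ²]_Φ = 0`, `τ = (0,−1;1,−1)` (telescoping around `g·∞, g·0, g·1`: the
first columns of `gτ`, `gτS`, `gτ²`, `gτ²S` are those of `gS`, `−(g + gS)`-type, `gτS`, `g`). [cite: Manin1972, Thm. 1.9] -/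
theorem maninSymbol_three_term (Φ : ℚ → R) (g : SL(2, ℤ)) :
    let τ : SL(2, ℤ) := ⟨!![0, -1; 1, -1], by norm_num [Matrix.det_fin_two_of]⟩
    ((if (g 1 0) = 0 then 0 else Φ (((g 0 0 : ℚ)) / ((g 1 0 : ℚ)))) -
      (if ((g * ModularGroup.S) 1 0) = 0 then 0
        else Φ ((((g * ModularGroup.S) 0 0 : ℚ)) / (((g * ModularGroup.S) 1 0 : ℚ))))) +
    ((if ((g * τ) 1 0) = 0 then 0 else Φ ((((g * τ) 0 0 : ℚ)) / (((g * τ) 1 0 : ℚ)))) -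
      (if ((g * τ * ModularGroup.S) 1 0) = 0 then 0
        else Φ ((((g * τ * ModularGroup.S) 0 0 : ℚ)) / (((g * τ * ModularGroup.S) 1 0 : ℚ))))) +
    ((if ((g * τ * τ) 1 0) = 0 then 0 else Φ ((((g * τ * τ) 0 0 : ℚ)) / (((g * τ * τ) 1 0 : ℚ)))) -
      (if ((g * τ * τ * ModularGroup.S) 1 0) = 0 then 0
        else Φ ((((g * τ * τ * ModularGroup.S) 0 0 : ℚ)) /
          (((g * τ * τ * ModularGroup.S) 1 0 : ℚ))))) = 0 := by
  intro τ
  -- first columns: gS = (g01, g11); gτ = (g01, g11); gτS = (-(g00+g01), -(g10+g11)); gτ² = same; gτ²S = (g00, g10)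
  have eS := Matrix.two_mul_expl (g : Matrix (Fin 2) (Fin 2) ℤ)
    ((ModularGroup.S : SL(2, ℤ)) : Matrix (Fin 2) (Fin 2) ℤ)
  have eτ := Matrix.two_mul_expl (g : Matrix (Fin 2) (Fin 2) ℤ) (τ : Matrix (Fin 2) (Fin 2) ℤ)
  have eτS := Matrix.two_mul_expl ((g * τ : SL(2, ℤ)) : Matrix (Fin 2) (Fin 2) ℤ)
    ((ModularGroup.S : SL(2, ℤ)) : Matrix (Fin 2) (Fin 2) ℤ)
  have eττ := Matrix.two_mul_expl ((g * τ : SL(2, ℤ)) : Matrix (Fin 2) (Fin 2) ℤ) (τ : Matrix (Fin 2) (Fin 2) ℤ)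
  have eττS := Matrix.two_mul_expl ((g * τ * τ : SL(2, ℤ)) : Matrix (Fin 2) (Fin 2) ℤ)
    ((ModularGroup.S : SL(2, ℤ)) : Matrix (Fin 2) (Fin 2) ℤ)
  have hS00 : (g * ModularGroup.S) 0 0 = g 0 1 := by
    refine eS.1.trans ?_; simp [ModularGroup.coe_S]
  have hS10 : (g * ModularGroup.S) 1 0 = g 1 1 := by
    refine eS.2.2.1.trans ?_; simp [ModularGroup.coe_S]
  have hτ00 : (g * τ) 0 0 = g 0 1 := by refine eτ.1.trans ?_; simp [τ]
  have hτ10 : (g * τ) 1 0 = g 1 1 := by refine eτ.2.2.1.trans ?_; simp [τ]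
  have hτ01 : (g * τ) 0 1 = -g 0 0 - g 0 1 := by refine eτ.2.1.trans ?_; simp [τ]; ring
  have hτ11 : (g * τ) 1 1 = -g 1 0 - g 1 1 := by refine eτ.2.2.2.trans ?_; simp [τ]; ring
  have hτS00 : (g * τ * ModularGroup.S) 0 0 = -g 0 0 - g 0 1 := by
    refine eτS.1.trans ?_; simp [ModularGroup.coe_S, hτ01]
  have hτS10 : (g * τ * ModularGroup.S) 1 0 = -g 1 0 - g 1 1 := by
    refine eτS.2.2.1.trans ?_; simp [ModularGroup.coe_S, hτ11]
  have hττ00 : (g * τ * τ) 0 0 = -g 0 0 - g 0 1 := by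
    refine eττ.1.trans ?_; simp [τ, hτ00, hτ01]
  have hττ10 : (g * τ * τ) 1 0 = -g 1 0 - g 1 1 := by
    refine eττ.2.2.1.trans ?_; simp [τ, hτ10, hτ11]
  have hττ01 : (g * τ * τ) 0 1 = g 0 0 := by
    refine eττ.2.1.trans ?_; simp [τ, hτ00, hτ01]
  have hττ11 : (g * τ * τ) 1 1 = g 1 0 := by
    refine eττ.2.2.2.trans ?_; simp [τ, hτ10, hτ11]
  have hττS00 : (g * τ * τ * ModularGroup.S) 0 0 = g 0 0 := by
    refine eττS.1.trans ?_; simp [ModularGroup.coe_S, hττ01]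
  have hττS10 : (g * τ * τ * ModularGroup.S) 1 0 = g 1 0 := by
    refine eττS.2.2.1.trans ?_; simp [ModularGroup.coe_S, hττ11]
  rw [hS00, hS10, hτ00, hτ10, hτS00, hτS10, hττ00, hττ10, hττS00, hττS10]
  abel

/-- **The `*`-involution fixes the Manin symbols of an EVEN symbol function**: for `ε = diag(−1,1)`,
`(εgε)·∞ = −(g·∞)` and `(εgε)·0 = −(g·0)`, so `Φ̂(εgε) = Φ̂(g)` whenever `Φ(−r) = Φ(r)` — stated on the entries:
cusp value at `(a, −b; −c, d)` equals the cusp value at `(a, b; c, d)`. (Complex conjugation on `X₀(N)(ℂ)` is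
`r ↦ −r` on cusps; evenness of `Φ` = invariance under it; cf. (C3k)'s hypothesis.) [cite: CremonaAlgorithms1997, §2.1.3] -/
theorem maninCusp_signConj_of_even (hev : ∀ r : ℚ, Φ (-r) = Φ r) (a c : ℤ) :
    (if (-c) = 0 then (0 : R) else Φ (((a : ℤ) : ℚ) / ((-c : ℤ) : ℚ))) =
      (if c = 0 then 0 else Φ (((a : ℤ) : ℚ) / ((c : ℤ) : ℚ))) := by
  by_cases hc : c = 0
  · rw [if_pos (neg_eq_zero.mpr hc), if_pos hc]
  · rw [if_neg (neg_ne_zero.mpr hc), if_neg hc, Int.cast_neg, div_neg, hev]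

end ManinSymbols

/-! ## §3. σ-fixed cosets: the Manin symbol is minus an elliptic period, killed by `T₂` -/

section SigmaFixed

/-- **σ-fixed cosets carry elliptic periods**: if `γ g = g S` with `γ ∈ Γ₀(N)` (the coset `Γ₀(N)g` is fixed by
`S`; then `γ = gSg⁻¹` has trace `0` and order `4`), the Manin symbol of `Φ` at `g` is `−Φ(γ·∞)`.
[cite: Manin1972, §1.5–1.7] -/
theorem maninSymbol_eq_neg_maninCusp_of_sigmaFixed
    (hM : ∀ (γ : Gamma0 N) (r : ℚ), ((γ : SL(2, ℤ)) 1 0 : ℚ) * r + ((γ : SL(2, ℤ)) 1 1 : ℚ) ≠ 0 →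
      Φ ((((γ : SL(2, ℤ)) 0 0 : ℚ) * r + ((γ : SL(2, ℤ)) 0 1 : ℚ)) /
        (((γ : SL(2, ℤ)) 1 0 : ℚ) * r + ((γ : SL(2, ℤ)) 1 1 : ℚ))) =
        (if ((γ : SL(2, ℤ)) 1 0) = 0 then 0 else Φ ((((γ : SL(2, ℤ)) 0 0 : ℚ)) / (((γ : SL(2, ℤ)) 1 0 : ℚ)))) + Φ r)
    (γ : Gamma0 N) (g : SL(2, ℤ)) (hfix : (γ : SL(2, ℤ)) * g = g * ModularGroup.S) :
    (if (g 1 0) = 0 then 0 else Φ (((g 0 0 : ℚ)) / ((g 1 0 : ℚ)))) -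
      (if ((g * ModularGroup.S) 1 0) = 0 then 0
        else Φ ((((g * ModularGroup.S) 0 0 : ℚ)) / (((g * ModularGroup.S) 1 0 : ℚ)))) =
      -(if ((γ : SL(2, ℤ)) 1 0) = 0 then 0 else Φ ((((γ : SL(2, ℤ)) 0 0 : ℚ)) / (((γ : SL(2, ℤ)) 1 0 : ℚ)))) := by
  have h := maninCusp_gamma0_mul_sl hM γ g
  rw [hfix] at h
  rw [h]
  abel

/-- If `γ g = g S` then `γ` has trace zero (it is `g S g⁻¹`). [folklore] -/
theorem trace_zero_of_sigmaFixed (γ : Gamma0 N) (g : SL(2, ℤ))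
    (hfix : (γ : SL(2, ℤ)) * g = g * ModularGroup.S) :
    (γ : SL(2, ℤ)) 1 1 = -((γ : SL(2, ℤ)) 0 0) := by
  have e1 := Matrix.two_mul_expl ((γ : SL(2, ℤ)) : Matrix (Fin 2) (Fin 2) ℤ) (g : Matrix (Fin 2) (Fin 2) ℤ)
  have e2 := Matrix.two_mul_expl (g : Matrix (Fin 2) (Fin 2) ℤ)
    ((ModularGroup.S : SL(2, ℤ)) : Matrix (Fin 2) (Fin 2) ℤ)
  have hdet : g 0 0 * g 1 1 - g 0 1 * g 1 0 = 1 := by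
    have := Matrix.det_fin_two g.1
    rw [g.2] at this
    linear_combination -this
  have hγdet : (γ : SL(2, ℤ)) 0 0 * (γ : SL(2, ℤ)) 1 1 - (γ : SL(2, ℤ)) 0 1 * (γ : SL(2, ℤ)) 1 0 = 1 := by
    have := Matrix.det_fin_two (γ : SL(2, ℤ)).1
    rw [(γ : SL(2, ℤ)).2] at this
    linear_combination -this
  have hm : ((γ : SL(2, ℤ)) : Matrix (Fin 2) (Fin 2) ℤ) * (g : Matrix (Fin 2) (Fin 2) ℤ) =
      (g : Matrix (Fin 2) (Fin 2) ℤ) * ((ModularGroup.S : SL(2, ℤ)) : Matrix (Fin 2) (Fin 2) ℤ) := by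
    rw [← Matrix.SpecialLinearGroup.coe_mul, ← Matrix.SpecialLinearGroup.coe_mul, hfix]
  have h00 := congrFun (congrFun hm 0) 0
  have h01 := congrFun (congrFun hm 0) 1
  have h10 := congrFun (congrFun hm 1) 0
  have h11 := congrFun (congrFun hm 1) 1
  rw [e1.1, e2.1] at h00
  rw [e1.2.1, e2.2.1] at h01
  rw [e1.2.2.1, e2.2.2.1] at h10
  rw [e1.2.2.2, e2.2.2.2] at h11
  simp [ModularGroup.coe_S] at h00 h01 h10 h11
  -- `γ g = g S`: (γ00 g00 + γ01 g10, γ00 g01 + γ01 g11; γ10 g00 + γ11 g10, γ10 g01 + γ11 g11) = (g01, -g00; g11, -g10)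
  -- ⇒ trace γ · det g = 0
  have key : ((γ : SL(2, ℤ)) 0 0 + (γ : SL(2, ℤ)) 1 1) * (g 0 0 * g 1 1 - g 0 1 * g 1 0) = 0 := by
    linear_combination g 1 1 * h00 - g 1 0 * h01 - g 0 1 * h10 + g 0 0 * h11
  rw [hdet, mul_one] at key
  linear_combination key

/-- **Eigen-symbols vanish on σ-fixed cosets (exact form)**: `N` odd, `Φ` a Γ₀(N)-symbol function with `T₂Φ = 0`
pointwise (e.g. valued in characteristic `2` with `T₂`-eigenvalue `a₂ ≡ 0`): for every `g ∈ SL₂(ℤ)` whose coset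
`Γ₀(N)g` is fixed by `S` (`γg = gS`), the Manin symbol `[g]_Φ` is `0` — the symbol descends to the quotient of the
integral Manin-symbol module by its `2`-torsion. (`…EllipticExclusion.maninCusp_eq_zero_of_trace_zero_of_heckeTwo`
+ §3.) [cite: Merel1994, §1.2–1.3] -/
theorem maninSymbol_eq_zero_of_sigmaFixed_of_heckeTwo (hN : Odd N)
    (hM : ∀ (γ : Gamma0 N) (r : ℚ), ((γ : SL(2, ℤ)) 1 0 : ℚ) * r + ((γ : SL(2, ℤ)) 1 1 : ℚ) ≠ 0 →
      Φ ((((γ : SL(2, ℤ)) 0 0 : ℚ) * r + ((γ : SL(2, ℤ)) 0 1 : ℚ)) /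
        (((γ : SL(2, ℤ)) 1 0 : ℚ) * r + ((γ : SL(2, ℤ)) 1 1 : ℚ))) =
        (if ((γ : SL(2, ℤ)) 1 0) = 0 then 0 else Φ ((((γ : SL(2, ℤ)) 0 0 : ℚ)) / (((γ : SL(2, ℤ)) 1 0 : ℚ)))) + Φ r)
    (hT : ∀ x : ℚ, (∑ j : Fin 2, Φ ((x + j) / 2)) + Φ (2 * x) = 0)
    (γ : Gamma0 N) (g : SL(2, ℤ)) (hfix : (γ : SL(2, ℤ)) * g = g * ModularGroup.S) :
    (if (g 1 0) = 0 then 0 else Φ (((g 0 0 : ℚ)) / ((g 1 0 : ℚ)))) -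
      (if ((g * ModularGroup.S) 1 0) = 0 then 0
        else Φ ((((g * ModularGroup.S) 0 0 : ℚ)) / (((g * ModularGroup.S) 1 0 : ℚ)))) = 0 := by
  rw [maninSymbol_eq_neg_maninCusp_of_sigmaFixed hM γ g hfix, neg_eq_zero]
  have htr := trace_zero_of_sigmaFixed γ g hfix
  by_cases hc : (γ : SL(2, ℤ)) 1 0 = 0
  · rw [if_pos hc]
  · rw [if_neg hc]
    exact maninCusp_eq_zero_of_trace_zero_of_heckeTwo hN hM hT γ htr

/-- **Eigen-symbols are small on σ-fixed cosets (ultrametric form, as used for (C3)/(C3k))**: over an ultrametric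
normed ring, if `‖Φ‖ ≤ 1` and `‖T₂Φ − aΦ‖ < 1` with `‖a‖ < 1`, then `‖[g]_Φ‖ < 1` at every σ-fixed coset (`N` odd).
[cite: Merel1994, §1.2–1.3] -/
theorem norm_maninSymbol_lt_one_of_sigmaFixed {K : Type*} [NormedRing K] [IsUltrametricDist K] (hN : Odd N)
    (Ψ : ℚ → K) (a : K) (ha : ‖a‖ < 1)
    (hM : ∀ (γ : Gamma0 N) (r : ℚ), ((γ : SL(2, ℤ)) 1 0 : ℚ) * r + ((γ : SL(2, ℤ)) 1 1 : ℚ) ≠ 0 →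
      Ψ ((((γ : SL(2, ℤ)) 0 0 : ℚ) * r + ((γ : SL(2, ℤ)) 0 1 : ℚ)) /
        (((γ : SL(2, ℤ)) 1 0 : ℚ) * r + ((γ : SL(2, ℤ)) 1 1 : ℚ))) =
        (if ((γ : SL(2, ℤ)) 1 0) = 0 then 0 else Ψ ((((γ : SL(2, ℤ)) 0 0 : ℚ)) / (((γ : SL(2, ℤ)) 1 0 : ℚ)))) + Ψ r)
    (hle : ∀ r : ℚ, ‖Ψ r‖ ≤ 1)
    (hT : ∀ x : ℚ, ‖(∑ j : Fin 2, Ψ ((x + j) / 2)) + Ψ (2 * x) - a * Ψ x‖ < 1)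
    (γ : Gamma0 N) (g : SL(2, ℤ)) (hfix : (γ : SL(2, ℤ)) * g = g * ModularGroup.S) :
    ‖(if (g 1 0) = 0 then 0 else Ψ (((g 0 0 : ℚ)) / ((g 1 0 : ℚ)))) -
      (if ((g * ModularGroup.S) 1 0) = 0 then 0
        else Ψ ((((g * ModularGroup.S) 0 0 : ℚ)) / (((g * ModularGroup.S) 1 0 : ℚ))))‖ < 1 := by
  rw [maninSymbol_eq_neg_maninCusp_of_sigmaFixed hM γ g hfix, norm_neg]
  have htr := trace_zero_of_sigmaFixed γ g hfix
  by_cases hc : (γ : SL(2, ℤ)) 1 0 = 0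
  · rw [if_pos hc, norm_zero]; exact one_pos
  · rw [if_neg hc]
    exact norm_maninCusp_lt_one_of_trace_zero hN Ψ a ha hM hle hT γ htr

end SigmaFixed

end Summit.BirchSwinnertonDyer.BirchSwinnertonDyer.Theorems.ThetaLayerLambdaCongruenceAtTwo

end
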